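import Mathlib
import Literature.Computability.AlgebraicComplexity.NestFreeMatchingPoly
import Summits.ValiantsHypothesis.ValiantsHypothesis.Theorems.FifoMatchingNNDivisionHardLocalCofactor
import Summits.ValiantsHypothesis.ValiantsHypothesis.Theorems.FifoMatchingNNDivisionHardSupportBetween
import HarnessLib

/-!
# Route FifoMatching — crux `NNDivisionHard` (stmt-ValiantsHypothesis-21181): SHORT-ARC-LOCAL cofactors are not certificates
# — CONDITIONAL on a long-supported spread measure (the missing export, as a Lean hypothesis)

Composition of `LocalCofactor.complexity_longFace_le_of_shortLocal` (a cofactor on arcs of length `< ℓ₀` reduces to the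
long-arc face `NN_n^{≥ℓ₀}`) with the support-between union bound (`SupportBetween.one_le_complexity_mul_of_spread_of_support_between`):

* ★ `shortLocal_lower_bound_of_longSpreadMeasure` — **if a probability weighting `μ` of the nest-free perfect matchings of `[2n]`
  (`n ≥ 3`) is supported on matchings all of whose arcs have length `≥ ℓ₀` and respects every balanced split with mass `≤ β`,
  `4 · 2^u · (n+1)² · β < 1`, then every cofactor `h ≠ 0` all of whose variables are arcs of length `< ℓ₀` has
  `2^u ≤ L₊(NN_n · h)`.**

WHAT IS MISSING (the hypothesis, to be discharged by a later hand): the thick-queue measure of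
`NNMonotoneHardMeasure.exists_thick_measure` / `SupportGenericExpBound.exists_spread_measure_beating` (which gives `u ≥ n^{1/6}`)
IS such a `μ` with `ℓ₀ = L − m + 1` (FIFO pairing of `U^L v D^L`, thick middle: every arc is longer than `L − m`, of order
`n^{2/3}`), but its support property is not exported by those theorems.  With it: «cofactors on arcs shorter than `n^{2/3}`
(block products `Π_j ι_j(NN_β)`, window-local sums, …) are not quasi-polynomial certificates».
HONEST FRAMING: a conditional rung; stmt-21181 stays OPEN; nothing here bears on `NNNotVP` or on VP ≠ VNP (NOT proved).
References: Hrubeš–Yehudayoff 2021 §6 Problem 2 [HrubesYehudayoff2021]; Jerrum–Snir 1982 [JerrumSnir1982].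
-/

noncomputable section

-- Sub = Summit single-conjunct layout: the duplicated namespace component is mandated by the tree.
set_option linter.dupNamespace false
set_option autoImplicit false

namespace Summit.ValiantsHypothesis.ValiantsHypothesis.Theorems.FifoMatching.NNDivisionHard.ShortLocalConditional

open Finset MvPolynomial Literature.Computability.AlgebraicComplexity
open Summit.ValiantsHypothesis.ValiantsHypothesis.Theorems.FifoMatching.NNDivisionHard.StackPowersQueue
  (shiftMatching shiftMatching_mem)
open Summit.ValiantsHypothesis.ValiantsHypothesis.Theorems.FifoMatching.NNDivisionHard.LocalCofactor
  (complexity_longFace_le_of_shortLocal)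
open Summit.ValiantsHypothesis.ValiantsHypothesis.Theorems.FifoMatching.NNDivisionHard.SupportBetween
  (one_le_complexity_mul_of_spread_of_support_between)
open scoped NNReal BigOperators

variable {n : ℕ}

/-- The long-arc face has support inside that of `NN_n`. [folklore] -/
theorem support_longFace_subset (ℓ₀ : ℕ) :
    (∑ M ∈ (nestFreeMatchings (2 * n)).filter (fun M => ∀ i ∈ openers M,
        (i, M i) ∉ (univ : Finset (Fin (2 * n) × Fin (2 * n))).filter (fun e => (e.2 : ℕ) < (e.1 : ℕ) + ℓ₀)),
        arcMonomial ℝ≥0 M).support ⊆ (nestFreeMatchingPoly n ℝ≥0).support := by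
  classical
  intro x hx
  rw [support_sum_arcMonomial ((Finset.filter_subset _ _).trans nestFreeMatchings_subset_perfectMatchings),
    Finset.mem_image] at hx
  obtain ⟨M, hM, rfl⟩ := hx
  rw [support_nestFreeMatchingPoly, Finset.mem_image]
  exact ⟨M, (Finset.mem_filter.1 hM).1, rfl⟩

/-- A matching all of whose arcs are long lies in the long-arc face. [folklore] -/
theorem arcExponent_mem_support_longFace (ℓ₀ : ℕ) {M : Fin (2 * n) → Fin (2 * n)}
    (hM : M ∈ nestFreeMatchings (2 * n)) (hlong : ∀ i ∈ openers M, (i : ℕ) + ℓ₀ ≤ (M i : ℕ)) :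
    arcExponent M ∈ (∑ M ∈ (nestFreeMatchings (2 * n)).filter (fun M => ∀ i ∈ openers M,
        (i, M i) ∉ (univ : Finset (Fin (2 * n) × Fin (2 * n))).filter (fun e => (e.2 : ℕ) < (e.1 : ℕ) + ℓ₀)),
        arcMonomial ℝ≥0 M).support := by
  classical
  have hmem : M ∈ (nestFreeMatchings (2 * n)).filter (fun M => ∀ i ∈ openers M,
      (i, M i) ∉ (univ : Finset (Fin (2 * n) × Fin (2 * n))).filter (fun e => (e.2 : ℕ) < (e.1 : ℕ) + ℓ₀)) := by
    refine Finset.mem_filter.2 ⟨hM, fun i hi hcon => ?_⟩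
    have h1 : (M i : ℕ) < (i : ℕ) + ℓ₀ := (Finset.mem_filter.1 hcon).2
    have h2 := hlong i hi
    omega
  rw [mem_support_iff, coeff_sum_arcMonomial ((Finset.filter_subset _ _).trans nestFreeMatchings_subset_perfectMatchings),
    if_pos ⟨M, hmem, rfl⟩]
  exact one_ne_zero

/-- ★ **SHORT-ARC-LOCAL COFACTORS ARE NOT CERTIFICATES — conditional on a long-supported spread measure.**  If a probability
weighting `μ` of the nest-free perfect matchings of `[2n]` (`n ≥ 3`, `ℓ₀ ≤ n`) is supported on matchings all of whose arcs have
length `≥ ℓ₀`, respects every balanced split with mass `≤ β`, and `4 · 2^u · (n+1)² · β < 1`, then every cofactor `h ≠ 0`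
all of whose variables are arcs of length `< ℓ₀` has `2^u ≤ L₊(NN_n · h)`. [cite: HrubesYehudayoff2021, §6 Problem 2] -/
theorem shortLocal_lower_bound_of_longSpreadMeasure {ℓ₀ u : ℕ} (hn : 3 ≤ n) (hℓ : ℓ₀ ≤ n) {β : ℝ≥0}
    (μ : (Fin (2 * n) → Fin (2 * n)) → ℝ≥0) (hμ : ∑ M ∈ nestFreeMatchings (2 * n), μ M = 1)
    (hμlong : ∀ M ∈ nestFreeMatchings (2 * n), μ M ≠ 0 → ∀ i ∈ openers M, (i : ℕ) + ℓ₀ ≤ (M i : ℕ))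
    (hβ : ∀ S : Finset (Fin (2 * n)), 2 * n < 3 * S.card → 3 * S.card ≤ 4 * n →
      (∑ M ∈ (nestFreeMatchings (2 * n)).filter (fun M => ∀ i, i ∈ S ↔ M i ∈ S), μ M) ≤ β)
    (hbeat : 4 * (2 : ℝ) ^ u * ((n : ℝ) + 1) ^ 2 * (β : ℝ) < 1)
    {h : MvPolynomial (Fin (2 * n) × Fin (2 * n)) ℝ≥0} (hh : h ≠ 0)
    (hshort : ∀ e ∈ h.vars, (e.2 : ℕ) < (e.1 : ℕ) + ℓ₀) :
    2 ^ u ≤ complexity (nestFreeMatchingPoly n ℝ≥0 * h) := by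
  have hred := complexity_longFace_le_of_shortLocal hℓ hh hshort
  have hone := one_le_complexity_mul_of_spread_of_support_between hn (support_longFace_subset ℓ₀) μ hμ
    (fun M hM hμM => arcExponent_mem_support_longFace ℓ₀ hM (hμlong M hM hμM)) hβ
  set F := complexity (∑ M ∈ (nestFreeMatchings (2 * n)).filter (fun M => ∀ i ∈ openers M,
        (i, M i) ∉ (univ : Finset (Fin (2 * n) × Fin (2 * n))).filter (fun e => (e.2 : ℕ) < (e.1 : ℕ) + ℓ₀)),
        arcMonomial ℝ≥0 M) with hF
  -- `2^u < F` as reals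
  have hpos : 0 ≤ ((n : ℝ) + 1) ^ 2 * (β : ℝ) := by positivity
  have hlt : (2 : ℝ) ^ u < (F : ℝ) := by
    by_contra hge
    push Not at hge
    have : 4 * (F : ℝ) * ((n : ℝ) + 1) ^ 2 * (β : ℝ) ≤ 4 * (2 : ℝ) ^ u * ((n : ℝ) + 1) ^ 2 * (β : ℝ) := by
      have := mul_le_mul_of_nonneg_right hge hpos
      nlinarith
    linarith
  have hlt' : 2 ^ u < F := by exact_mod_cast hlt
  omega

end Summit.ValiantsHypothesis.ValiantsHypothesis.Theorems.FifoMatching.NNDivisionHard.ShortLocalConditional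

end
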